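import Summits.BirchSwinnertonDyer.Rank1Residual.Additive.RationalLineOfKernelPolynomial
import HarnessLib

/-!
# The rational `p`-line of a kernel-polynomial certificate consists EXACTLY of the points above the
# roots of `h` (converse of the keystone; cell `bsd-addord`, seat `bsd-addord-twist`)

HONEST FRAMING (cell `bsd-addord`, `run/shared/lean/pub/bsd-addord/README.md` §4): the programme's
target of record is the full Birch–Swinnerton-Dyer formula for every `E/ℚ` of analytic rank `≤ 1`;
this is a TOOL file (elementary theory of division polynomials; theorems only, no definition, no named
fact, no `sorry`). It books nothing.

## What

`RationalLineOfKernelPolynomial.lean` (`KernelPolyLine.exists_isRationalLine_of_kernelPolyCert`)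
turns a KERNEL-POLYNOMIAL CERTIFICATE `(h, q, q₂)` at an odd prime `p` — (c1) `W.preΨ' p = h * q`,
(c2) the doubling closure `∑_{i ≤ m} h_i Φ₂^i Ψ₂Sq^{m−i} = h * q₂` with `natDegree h ≤ m`,
`2m + 1 = p`, (c3) `±2` generates `𝔽_pˣ`, a root of `h` in `ℚ̄` — into a rational `p`-line
`Φ ≤ E[p]` (`IsRationalLine W p Φ`) «every non-zero point of which has abscissa a root of `h`».
This sequel exports the CONVERSE inclusion, which the keystone's proof contains (`T = ℤP₀`) but its
statement does not: **every geometric point whose abscissa is a root of `h` is a (non-zero) point of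
`Φ`** (`exists_isRationalLine_of_kernelPolyCert_iff`). Proof (counting, from the keystone's output
alone): the `p − 1` non-zero points of `Φ` inject into the set `A` of points above the roots of `h`,
and `#A = 2 · #roots ≤ 2m = p − 1` (tree `encard_setOf_X_mem`; `Ψ₂Sq ≠ 0` at the roots), so the
image is all of `A`.

WHY (Files B/C of the Φ₀ kernel-records programme at `p ≥ 5`, HANDOFF § twist gen 6 item (0)): the
parity certificate (trace of `Ψ₂Sq` over the roots of `h`) and the twisted-ramification certificate
read a property of the line at EVERY root of `h`, so they need every root to carry a point of `Φ`.
Corollaries recorded here: `h` has exactly `m` distinct roots in `ℚ̄`, hence `natDegree h = m` and `h`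
is separable-as-a-set (`card_roots_toFinset_eq`), and the abscissa of any point above a root is fixed
by complex conjugation / is real (`exists_mem_of_eval_eq_zero`).

References: J. H. Silverman, *AEC* 2nd ed., Exercise 3.7 [SilvermanAEC2009]; R. Greenberg, V. Vatsal,
Invent. Math. 142 (2000) p. 4 [GreenbergVatsal2000]; `Additive/RationalLineOfKernelPolynomial.lean`.
-/

set_option autoImplicit false

noncomputable section

open scoped Classical

open WeierstrassCurve Polynomial Literature.NumberTheory.EllipticCurves
  Literature.NumberTheory.EllipticCurves.Rank1Residual Field

namespace Summit.BirchSwinnertonDyer.Rank1Residual.Additive.KernelPolyLine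

variable {W : WeierstrassCurve ℚ} [W.IsElliptic] {p : ℕ} [Fact p.Prime]

/-- **Counting lemma.** If `Φ ≤ E[p]` is a rational `p`-line (`p` odd) every non-zero point of which
has abscissa a root of `h`, where `W.preΨ' p = h * q` and `natDegree h ≤ m`, `2m + 1 = p`, then
conversely every geometric point `(x, y)` with `h(x) = 0` is a non-zero point of `Φ`. [folklore] -/
theorem exists_mem_of_eval_eq_zero (hp2 : p ≠ 2) {h q : ℚ[X]} {m : ℕ} (hm : 2 * m + 1 = p)
    (hdeg : h.natDegree ≤ m) (hdiv : W.preΨ' p = h * q)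
    {Φ : AddSubgroup (geomTorsion W (p : ℤ))} (hΦ : IsRationalLine W p Φ)
    (habs : ∀ Q ∈ Φ, Q ≠ 0 → ∃ (x y : AlgebraicClosure ℚ)
      (hxy : (W.baseChange (AlgebraicClosure ℚ)).toAffine.Nonsingular x y),
      (Q : W.geomPoints) = Affine.Point.some x y hxy ∧
        (h.map (algebraMap ℚ (AlgebraicClosure ℚ))).eval x = 0)
    {x y : AlgebraicClosure ℚ} (hxy : (W.baseChange (AlgebraicClosure ℚ)).toAffine.Nonsingular x y)
    (hx : (h.map (algebraMap ℚ (AlgebraicClosure ℚ))).eval x = 0) :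
    ∃ Q ∈ Φ, Q ≠ 0 ∧ (Q : W.geomPoints) = Affine.Point.some x y hxy := by
  have hp : p.Prime := Fact.out
  have hodd : Odd p := hp.odd_of_ne_two hp2
  -- the roots of `h` and the set `A` of points above them
  have hh0 : h.map (algebraMap ℚ (AlgebraicClosure ℚ)) ≠ 0 := by
    intro h0
    have hz : h = 0 := (Polynomial.map_eq_zero (algebraMap ℚ (AlgebraicClosure ℚ))).mp h0
    have hpre : W.preΨ' p ≠ 0 := W.preΨ'_ne_zero (by exact_mod_cast hp.ne_zero)
    rw [hz, zero_mul] at hdiv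
    exact hpre hdiv
  set R : Finset (AlgebraicClosure ℚ) := ((h.map (algebraMap ℚ (AlgebraicClosure ℚ))).roots).toFinset
    with hR
  have hmemR : ∀ z : AlgebraicClosure ℚ, (h.map (algebraMap ℚ (AlgebraicClosure ℚ))).eval z = 0 ↔ z ∈ R := by
    intro z
    rw [hR, Multiset.mem_toFinset, mem_roots hh0, IsRoot.def]
  have hRcard : R.card ≤ m := by
    calc R.card ≤ Multiset.card (h.map (algebraMap ℚ (AlgebraicClosure ℚ))).roots := Multiset.toFinset_card_le _
      _ ≤ (h.map (algebraMap ℚ (AlgebraicClosure ℚ))).natDegree := card_roots' _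
      _ ≤ h.natDegree := natDegree_map_le
      _ ≤ m := hdeg
  have hRΨ : ∀ z ∈ R, ((W.baseChange (AlgebraicClosure ℚ)).Ψ₂Sq).eval z ≠ 0 := fun z hz ↦
    eval_Ψ₂Sq_ne_zero_of_eval_eq_zero hodd hdiv ((hmemR z).mpr hz)
  set A : Set (W.baseChange (AlgebraicClosure ℚ)).toAffine.Point := {P | ∃ x y, ∃ hxy : (W.baseChange (AlgebraicClosure ℚ)).toAffine.Nonsingular x y,
      P = Affine.Point.some x y hxy ∧ x ∈ R} with hA
  have hAcard : A.encard = 2 * R.card := (W.baseChange (AlgebraicClosure ℚ)).encard_setOf_X_mem R hRΨ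
  have hAfin : A.Finite := Set.finite_of_encard_eq_coe hAcard
  have hAncard : A.ncard = 2 * R.card := by
    have e := hAfin.cast_ncard_eq
    rw [hAcard] at e
    exact_mod_cast e
  -- the image of `Φ ∖ {0}` in `E(ℚ̄)` lies in `A` and has `p − 1` elements
  set B : Set (W.baseChange (AlgebraicClosure ℚ)).toAffine.Point := (fun Q : geomTorsion W (p : ℤ) ↦ (Q : W.geomPoints)) ''
      ((Φ : Set (geomTorsion W (p : ℤ))) \ {0}) with hB
  have hBA : B ⊆ A := by
    rintro P ⟨Q, ⟨hQΦ, hQ0⟩, rfl⟩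
    obtain ⟨x', y', hxy', he, hx'⟩ := habs Q hQΦ hQ0
    exact ⟨x', y', hxy', he, (hmemR x').mp hx'⟩
  have hΦfin : (Φ : Set (geomTorsion W (p : ℤ))).Finite := by
    have : Finite Φ := Nat.finite_of_card_ne_zero (by rw [hΦ.1]; exact hp.ne_zero)
    exact Set.toFinite _
  have hΦncard : (Φ : Set (geomTorsion W (p : ℤ))).ncard = p := by
    rw [← Nat.card_coe_set_eq]
    exact hΦ.1
  have h0mem : (0 : geomTorsion W (p : ℤ)) ∈ (Φ : Set (geomTorsion W (p : ℤ))) := Φ.zero_mem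
  have hdiffncard : ((Φ : Set (geomTorsion W (p : ℤ))) \ {0}).ncard = p - 1 := by
    rw [Set.ncard_sdiff_singleton_of_mem h0mem, hΦncard]
  have hBncard : B.ncard = p - 1 := by
    have hinj : Function.Injective (fun Q : geomTorsion W (p : ℤ) ↦ (Q : W.geomPoints)) :=
      fun a b hab ↦ Subtype.ext hab
    have e : B.ncard = ((Φ : Set (geomTorsion W (p : ℤ))) \ {0}).ncard :=
      Set.ncard_image_of_injective _ hinj
    rw [e, hdiffncard]
  have hle : A.ncard ≤ B.ncard := by
    rw [hAncard, hBncard]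
    omega
  have hBeq : B = A := Set.eq_of_subset_of_ncard_le hBA hle hAfin
  -- the given point lies in `A = B`
  have hPA : (Affine.Point.some x y hxy : (W.baseChange (AlgebraicClosure ℚ)).toAffine.Point) ∈ A := ⟨x, y, hxy, rfl, (hmemR x).mp hx⟩
  rw [← hBeq] at hPA
  obtain ⟨Q, ⟨hQΦ, hQ0⟩, hQ⟩ := hPA
  exact ⟨Q, hQΦ, hQ0, hQ⟩


/-- **The keystone with its converse.** Under a kernel-polynomial certificate `(h, q, q₂)` at the odd
prime `p` (hypotheses verbatim those of `exists_isRationalLine_of_kernelPolyCert`), `E[p]` contains a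
rational `p`-line `Φ` whose non-zero points are EXACTLY the geometric points whose abscissa is a root
of `h`: every non-zero point of `Φ` lies above a root of `h`, and every point above a root of `h` is a
non-zero point of `Φ`. [cite: SilvermanAEC2009, Exercise 3.7 (d),(f)] [cite: GreenbergVatsal2000, p. 4] -/
theorem exists_isRationalLine_of_kernelPolyCert_iff (hp2 : p ≠ 2) {h q q₂ : ℚ[X]} {m : ℕ}
    (hm : 2 * m + 1 = p) (hdeg : h.natDegree ≤ m) (hdiv : W.preΨ' p = h * q)
    (hdbl : ∑ i ∈ Finset.range (m + 1), C (h.coeff i) * W.Φ 2 ^ i * W.Ψ₂Sq ^ (m - i) = h * q₂)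
    (hgen : ∀ k : ZMod p, k ≠ 0 → ∃ (s : ℤˣ) (j : ℕ), k = ((s : ℤ) * 2 ^ j : ℤ))
    (hroot : ∃ α : (AlgebraicClosure ℚ), (h.map (algebraMap ℚ (AlgebraicClosure ℚ))).eval α = 0) :
    ∃ Φ : AddSubgroup (geomTorsion W (p : ℤ)), IsRationalLine W p Φ ∧
      (∀ Q ∈ Φ, Q ≠ 0 → ∃ (x y : (AlgebraicClosure ℚ))
        (hxy : (W.baseChange (AlgebraicClosure ℚ)).toAffine.Nonsingular x y),
        (Q : W.geomPoints) = Affine.Point.some x y hxy ∧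
          (h.map (algebraMap ℚ (AlgebraicClosure ℚ))).eval x = 0) ∧
      (∀ (x y : AlgebraicClosure ℚ) (hxy : (W.baseChange (AlgebraicClosure ℚ)).toAffine.Nonsingular x y),
        (h.map (algebraMap ℚ (AlgebraicClosure ℚ))).eval x = 0 →
          ∃ Q ∈ Φ, Q ≠ 0 ∧ (Q : W.geomPoints) = Affine.Point.some x y hxy) := by
  obtain ⟨Φ, hΦ, habs⟩ := exists_isRationalLine_of_kernelPolyCert hp2 hm hdeg hdiv hdbl hgen hroot
  exact ⟨Φ, hΦ, habs, fun x y hxy hx ↦ exists_mem_of_eval_eq_zero hp2 hm hdeg hdiv hΦ habs hxy hx⟩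

/-- **Every root of `h` is the abscissa of a non-zero point of the line** (there is a point of
`E(ℚ̄)` above every `x`, tree `exists_equation`). [folklore] -/
theorem exists_mem_abscissa_of_eval_eq_zero (hp2 : p ≠ 2) {h q : ℚ[X]} {m : ℕ} (hm : 2 * m + 1 = p)
    (hdeg : h.natDegree ≤ m) (hdiv : W.preΨ' p = h * q)
    {Φ : AddSubgroup (geomTorsion W (p : ℤ))} (hΦ : IsRationalLine W p Φ)
    (habs : ∀ Q ∈ Φ, Q ≠ 0 → ∃ (x y : AlgebraicClosure ℚ)
      (hxy : (W.baseChange (AlgebraicClosure ℚ)).toAffine.Nonsingular x y),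
      (Q : W.geomPoints) = Affine.Point.some x y hxy ∧
        (h.map (algebraMap ℚ (AlgebraicClosure ℚ))).eval x = 0)
    {x : AlgebraicClosure ℚ} (hx : (h.map (algebraMap ℚ (AlgebraicClosure ℚ))).eval x = 0) :
    ∃ Q ∈ Φ, Q ≠ 0 ∧ ∃ (y : AlgebraicClosure ℚ)
      (hxy : (W.baseChange (AlgebraicClosure ℚ)).toAffine.Nonsingular x y),
      (Q : W.geomPoints) = Affine.Point.some x y hxy := by
  obtain ⟨y, hy⟩ := (W.baseChange (AlgebraicClosure ℚ)).exists_equation x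
  have hxy : (W.baseChange (AlgebraicClosure ℚ)).toAffine.Nonsingular x y :=
    (W.baseChange (AlgebraicClosure ℚ)).toAffine.equation_iff_nonsingular.mp hy
  obtain ⟨Q, hQΦ, hQ0, hQ⟩ := exists_mem_of_eval_eq_zero hp2 hm hdeg hdiv hΦ habs hxy hx
  exact ⟨Q, hQΦ, hQ0, y, hxy, hQ⟩

/-- **`h` has exactly `m` distinct roots in `ℚ̄`** (they are the `m = (p − 1)/2` abscissas of the
`p − 1` non-zero points of the line, two points above each). [folklore] -/
theorem card_roots_toFinset_eq (hp2 : p ≠ 2) {h q : ℚ[X]} {m : ℕ} (hm : 2 * m + 1 = p)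
    (hdeg : h.natDegree ≤ m) (hdiv : W.preΨ' p = h * q)
    {Φ : AddSubgroup (geomTorsion W (p : ℤ))} (hΦ : IsRationalLine W p Φ)
    (habs : ∀ Q ∈ Φ, Q ≠ 0 → ∃ (x y : AlgebraicClosure ℚ)
      (hxy : (W.baseChange (AlgebraicClosure ℚ)).toAffine.Nonsingular x y),
      (Q : W.geomPoints) = Affine.Point.some x y hxy ∧
        (h.map (algebraMap ℚ (AlgebraicClosure ℚ))).eval x = 0) :
    ((h.map (algebraMap ℚ (AlgebraicClosure ℚ))).roots).toFinset.card = m ∧ h.natDegree = m := by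
  have hp : p.Prime := Fact.out
  have hodd : Odd p := hp.odd_of_ne_two hp2
  have hh0 : h.map (algebraMap ℚ (AlgebraicClosure ℚ)) ≠ 0 := by
    intro h0
    have hz : h = 0 := (Polynomial.map_eq_zero (algebraMap ℚ (AlgebraicClosure ℚ))).mp h0
    have hpre : W.preΨ' p ≠ 0 := W.preΨ'_ne_zero (by exact_mod_cast hp.ne_zero)
    rw [hz, zero_mul] at hdiv
    exact hpre hdiv
  set R : Finset (AlgebraicClosure ℚ) := ((h.map (algebraMap ℚ (AlgebraicClosure ℚ))).roots).toFinset
    with hR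
  have hmemR : ∀ z : AlgebraicClosure ℚ, (h.map (algebraMap ℚ (AlgebraicClosure ℚ))).eval z = 0 ↔ z ∈ R := by
    intro z
    rw [hR, Multiset.mem_toFinset, mem_roots hh0, IsRoot.def]
  have hRle : R.card ≤ h.natDegree := by
    calc R.card ≤ Multiset.card (h.map (algebraMap ℚ (AlgebraicClosure ℚ))).roots := Multiset.toFinset_card_le _
      _ ≤ (h.map (algebraMap ℚ (AlgebraicClosure ℚ))).natDegree := card_roots' _
      _ ≤ h.natDegree := natDegree_map_le
  have hRΨ : ∀ z ∈ R, ((W.baseChange (AlgebraicClosure ℚ)).Ψ₂Sq).eval z ≠ 0 := fun z hz ↦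
    eval_Ψ₂Sq_ne_zero_of_eval_eq_zero hodd hdiv ((hmemR z).mpr hz)
  -- `Φ ∖ {0}` injects into the points above `R`, which number `2 · #R`
  set A : Set (W.baseChange (AlgebraicClosure ℚ)).toAffine.Point := {P | ∃ x y,
      ∃ hxy : (W.baseChange (AlgebraicClosure ℚ)).toAffine.Nonsingular x y,
      P = Affine.Point.some x y hxy ∧ x ∈ R} with hA
  have hAcard : A.encard = 2 * R.card := (W.baseChange (AlgebraicClosure ℚ)).encard_setOf_X_mem R hRΨ
  have hAfin : A.Finite := Set.finite_of_encard_eq_coe hAcard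
  have hAncard : A.ncard = 2 * R.card := by
    have e := hAfin.cast_ncard_eq
    rw [hAcard] at e
    exact_mod_cast e
  set B : Set (W.baseChange (AlgebraicClosure ℚ)).toAffine.Point :=
      (fun Q : geomTorsion W (p : ℤ) ↦ (Q : W.geomPoints)) '' ((Φ : Set (geomTorsion W (p : ℤ))) \ {0}) with hB
  have hBA : B ⊆ A := by
    rintro P ⟨Q, ⟨hQΦ, hQ0⟩, rfl⟩
    obtain ⟨x', y', hxy', he, hx'⟩ := habs Q hQΦ hQ0
    exact ⟨x', y', hxy', he, (hmemR x').mp hx'⟩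
  have hΦfin : (Φ : Set (geomTorsion W (p : ℤ))).Finite := by
    have : Finite Φ := Nat.finite_of_card_ne_zero (by rw [hΦ.1]; exact hp.ne_zero)
    exact Set.toFinite _
  have hΦncard : (Φ : Set (geomTorsion W (p : ℤ))).ncard = p := by
    rw [← Nat.card_coe_set_eq]
    exact hΦ.1
  have hdiffncard : ((Φ : Set (geomTorsion W (p : ℤ))) \ {0}).ncard = p - 1 := by
    rw [Set.ncard_sdiff_singleton_of_mem Φ.zero_mem, hΦncard]
  have hBncard : B.ncard = p - 1 := by
    have hinj : Function.Injective (fun Q : geomTorsion W (p : ℤ) ↦ (Q : W.geomPoints)) :=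
      fun a b hab ↦ Subtype.ext hab
    have e : B.ncard = ((Φ : Set (geomTorsion W (p : ℤ))) \ {0}).ncard :=
      Set.ncard_image_of_injective _ hinj
    rw [e, hdiffncard]
  have hle : B.ncard ≤ A.ncard := Set.ncard_le_ncard hBA hAfin
  rw [hAncard, hBncard] at hle
  constructor <;> omega

end Summit.BirchSwinnertonDyer.Rank1Residual.Additive.KernelPolyLine

end
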